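import Summits.CriticalPhenomena.PercolationContinuityZ3.Theses.PercNearOneGluing
import Literature.Probability.Percolation.PercolationProofs
import Literature.Probability.Percolation.ConditionalPositiveAssociationProofs
import Literature.Probability.Percolation.TwoClusterConditionalAssociationProofs
import Summits.CriticalPhenomena.PercolationContinuityZ3.Theorems.PercNearOneGluingAdditiveGluingGoodTwoRelays

/-! TTRL-lite variant V204 of stmt-CriticalPhenomena-4576 -/

namespace Summit.CriticalPhenomena.PercolationContinuityZ3.Theorems

open MeasureTheory Literature.Probability.LatticeModels Literature.Probability.Percolation
open scoped Classical BigOperators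

/-- TTRL-lite variant V204 (`card_eq:A=2;bound_nat:n≤5`, hypotheses in the order `n ≤ 5`,
`A.card = 2`) of the registered stub `stub_goodStep` of stmt-CriticalPhenomena-4576: on at most five
vertices with `A.card = 2` the inductive step of the good-quadruple (penalised-selection) inequality
`μ(o ↔ A, o ↮ b) + Σ_{W dead} μ(C(o) = W) · μ({sel W ↔ b in Wᶜ}ᶜ) ≤ t`
holds.  With `A = {a, b}` every summand with `sel W = b` vanishes (`b ↔ b in Wᶜ` is sure for
`b ∉ W`) and with `sel W = a` the domain Markov property gives
`μ(C(o) = W) · μ({a ↔ b in Wᶜ}ᶜ) = μ(C(o) = W, a ↮ b)`, so the left side is at most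
`μ(o ↔ a, a ↮ b) + μ(o ↮ a, a ↮ b) = μ(a ↮ b) ≤ t` (the one-relay union bound).  Formally it is a
direct specialisation of the two-relay goodness theorem `stub_goodStepTwoRelays_k41` (any `n`,
`A.card ≤ 3`); neither the bound `n ≤ 5`, nor the low-neighbour hypothesis, nor the induction
hypothesis is needed. [this project] -/
theorem stub_goodStep_var204 : ∀ (n : ℕ) (w : Sym2 (Fin n) → unitInterval) (A : Finset (Fin n)) (o b : Fin n), n ≤ 5 → A.card = 2 → b ∈ A → o ∉ A → (∃ y : Fin n, y ∉ A ∧ y ≠ o ∧ (w s(o, y) : ℝ) ≠ 0) → (∀ w' : Sym2 (Fin n) → unitInterval, (Finset.univ.filter (fun v : Fin n => ∃ u : Fin n, 0 < (w' s(u, v) : ℝ))).card < (Finset.univ.filter (fun v : Fin n => ∃ u : Fin n, 0 < (w s(u, v) : ℝ))).card → ∀ (A' : Finset (Fin n)) (o' b' : Fin n), b' ∈ A' → o' ∉ A' → ∀ (t : ℝ) (sel : Finset (Fin n) → Fin n), (∀ W, sel W ∈ A') → (∀ a ∈ A', 1 - t ≤ (prodBernoulli w').real (openConn a b')) → (prodBernoulli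 w').real ((⋃ a ∈ A', openConn o' a) ∩ (openConn o' b')ᶜ) + ∑ W ∈ (Finset.univ : Finset (Finset (Fin n))).filter (fun W => o' ∈ W ∧ Disjoint W A'), (prodBernoulli w').real {ω : BondConfig (Fin n) | openCluster ω o' = (W : Set (Fin n))} * (prodBernoulli w').real (openConnIn ((W : Set (Fin n))ᶜ) (sel W) b')ᶜ ≤ t) → ∀ (t : ℝ) (sel : Finset (Fin n) → Fin n), (∀ W, sel W ∈ A) → (∀ a ∈ A, 1 - t ≤ (prodBernoulli w).real (openConn a b)) → (prodBernoulli w).real ((⋃ a ∈ A, openConn o a) ∩ (openConn o b)ᶜ) + ∑ W ∈ (Finset.univ : Finset (Finset (Fin n))).filter (fun W => o ∈ W ∧ Disjoint W A), (prodBernoulli w).real {ω : BondConfig (Fin n) | openCluster ω o = (W : Set (Fin n))} * (prodBernoulli w).real (openConnIn ((W : Set (Fin n))ᶜ) (sel W) b)ᶜ ≤ t := by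
  intro n w A o b _hn hA hbA hoA _hy _ih t sel hsel hrel
  exact stub_goodStepTwoRelays_k41 n w A o b hbA hoA (by omega) t sel hsel hrel

end Summit.CriticalPhenomena.PercolationContinuityZ3.Theorems
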